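import Summits.ResolutionOfSingularities.ResolutionOfSingularities.Theorems.EquisingularLiftEquisingularLiftNatBadLocus
import Mathlib.RingTheory.DiscreteValuationRing.Basic
import Mathlib.RingTheory.LocalRing.Quotient
import HarnessLib

/-!
# [OURS · L1 W4.5(b) · EL♮] RIBBON MULTIPLICITY AT A BAD POINT: a centre through a bad point whose local ring there is a DVR carries its
# special-fibre component with multiplicity `≥ 2` — the kernel form of DSHARP-VOID §1 (1c)(1d) / §2 (2c)
# (crux `EquisingularLiftNat` = stmt-ResolutionOfSingularities-20038; PARENT ≥ 4 band / kill test #50, door (d♯))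

HONEST FRAMING. OURS (cell res-hironaka, crux chain w45b, slot W4.5(b)); NOT a statement of any manuscript; replaces the role of NOTHING
in the manuscript; AI-written, AI review is weaker than expert review. Helper `--supports stmt-ResolutionOfSingularities-20038 --as helper`.
Companion of `…NatRibbonBad` (p557704: after a ribbon touch the new `v`-centre is a BAD point) and `…NatBadLocus` (p530616: bad points
stay bad under every morphism over `Spec O`). Memo `L/res-L1-w45b-lead-1/DSHARP-VOID.md` (res-L1-w45b-lead-1 gen 7).

THE POINT. In an E1 chain a centre `C ⊂ P′` is regular and `O`-flat; at the generic point `η` of a component `Z` of `(C_s)_red` with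
`dim C = dim Z + 1` the local ring `𝒪_{C,η}` is a DVR, and the MULTIPLICITY of `Z` in the special fibre `C_s = V(ϖ)` is the valuation
`v_{𝒪_{C,η}}(ϖ)`. If `η` is a BAD point of the ambient (`ϖ ∈ 𝔪²_{P′,η}`), then `ϖ ∈ 𝔪²_{C,η}` (the quotient / stalk map is local), so the
valuation is `≥ 2`: the centre is a RIBBON along `Z`, never reduced there. With `…NatRibbonBad` this is why door (d♯) — a type-(II)
centre with REDUCED special fibre along the non-normal ruled `v`-centre — never occurs (DSHARP-VOID §2), and why at a bad avatar point the
first progress touch is itself a ribbon (§1 (1d)).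

* `RibbonMultiplicity.mem_maximalIdeal_pow_iff_of_surjective` — for a surjective `f : A → D` of local rings, `f x ∈ 𝔪_D^n ↔ x ∈ ker f ⊔ 𝔪_A^n`
  (so for the DVR `𝒪_{C,η} = 𝒪_{P′,η}/J`: multiplicity `≥ 2 ↔ ϖ ∈ J + 𝔪²`, multiplicity `1 ↔ ϖ ∉ J + 𝔪²`; DSHARP-VOID §1 (1c)).
* `RibbonMultiplicity.le_addVal_of_mem_pow` — in a DVR, `x ∈ 𝔪^n ⇒ n ≤ v(x)`; `not_irreducible_of_mem_sq` — `x ∈ 𝔪² ⇒ x` is not a uniformiser.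
* `RibbonMultiplicity.two_le_addVal_varpiGerm_of_bad` (scheme level, `…NatBadLocus` currency) — for `f : C → P′` over `Spec O`
  (e.g. the closed immersion of a centre) and a point `c` over a BAD point `f c` with `𝒪_{C,c}` a DVR: `2 ≤ v(ϖ_c)` and `ϖ_c` is not a uniformiser.

References: Mathlib `IsLocalRing.map_maximalIdeal_of_surjective`, `Ideal.comap_map_of_surjective`, `IsDiscreteValuationRing.addVal_le_iff_dvd`;
tree `…NatBadLocus.varpiGerm_mem_sq_of_over`. [folklore]
-/

set_option linter.dupNamespace false -- mandated namespace `Summit.<Summit>.<Problem>` of this single-conjunct summit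

universe u

open CategoryTheory AlgebraicGeometry TopologicalSpace IsLocalRing

namespace Summit.ResolutionOfSingularities.ResolutionOfSingularities.Cruxes.EquisingularLiftNat.Sections

namespace RibbonMultiplicity

/-! ## Powers of the maximal ideal under a surjection of local rings -/

/-- For a SURJECTIVE homomorphism `f : A → D` of local rings and any `n`: `f x ∈ 𝔪_D ^ n ↔ x ∈ ker f ⊔ 𝔪_A ^ n` — since
`𝔪_A · D = 𝔪_D` (Mathlib `IsLocalRing.map_maximalIdeal_of_surjective`). Read with `D = 𝒪_{P′,η}/J = 𝒪_{C,η}` a DVR and `x = ϖ`: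
the multiplicity of the special fibre of the centre at `η` is `≥ 2` iff `ϖ ∈ J + 𝔪²`. OURS. [folklore] -/
theorem mem_maximalIdeal_pow_iff_of_surjective {A D : Type*} [CommRing A] [CommRing D] [IsLocalRing A] [IsLocalRing D]
    (f : A →+* D) (hf : Function.Surjective f) (x : A) (n : ℕ) :
    f x ∈ (maximalIdeal D) ^ n ↔ x ∈ RingHom.ker f ⊔ (maximalIdeal A) ^ n := by
  rw [← IsLocalRing.map_maximalIdeal_of_surjective f hf, ← Ideal.map_pow, ← Ideal.mem_comap,
    Ideal.comap_map_of_surjective f hf, sup_comm]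
  rfl

/-! ## Valuation bounds in a DVR -/

section DVR

variable {D : Type u} [CommRing D] [IsDomain D] [IsDiscreteValuationRing D]

/-- In a DVR: `x ∈ 𝔪 ^ n ⇒ n ≤ v(x)` (`v` = `IsDiscreteValuationRing.addVal`). [folklore] -/
theorem le_addVal_of_mem_pow {x : D} {n : ℕ} (hx : x ∈ (maximalIdeal D) ^ n) :
    (n : ℕ∞) ≤ IsDiscreteValuationRing.addVal D x := by
  obtain ⟨ϖ₀, hϖ₀⟩ := IsDiscreteValuationRing.exists_irreducible D
  rw [(IsDiscreteValuationRing.irreducible_iff_uniformizer ϖ₀).mp hϖ₀, Ideal.span_singleton_pow,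
    Ideal.mem_span_singleton] at hx
  rw [← hϖ₀.addVal_pow n]
  exact IsDiscreteValuationRing.addVal_le_iff_dvd.mpr hx

/-- In a DVR: an element of `𝔪²` has valuation `≥ 2`, so it is NOT a uniformiser (not irreducible). [folklore] -/
theorem not_irreducible_of_mem_sq {x : D} (hx : x ∈ (maximalIdeal D) ^ 2) : ¬ Irreducible x := by
  intro hirr
  have h2 := le_addVal_of_mem_pow hx
  rw [IsDiscreteValuationRing.addVal_uniformizer hirr] at h2
  exact absurd h2 (by decide)

end DVR

/-! ## Scheme level: multiplicity `≥ 2` at a bad point -/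

/-- **RIBBON MULTIPLICITY AT A BAD POINT.** Let `f : C → P′` be a morphism over `Spec O` (`f ≫ r′ = r_C`; e.g. the closed immersion of a
centre), `c ∈ C` a point whose local ring is a DVR (the generic point of a special-fibre component `Z` of `C` with `dim C = dim Z + 1`), and
suppose `f c` is a BAD point of `P′` (the germ of `ϖ` at `f c` lies in `𝔪²`). Then the germ `ϖ_c` of `ϖ` at `c` has valuation `≥ 2` and is
not a uniformiser: the special fibre `C_s = V(ϖ)` contains `Z` with MULTIPLICITY `≥ 2` — the centre is a ribbon along `Z`. OURS. [folklore] -/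
theorem two_le_addVal_varpiGerm_of_bad {O : Type} [CommRing O] {P' C : Scheme.{0}} (r' : P' ⟶ Spec (.of O)) (rC : C ⟶ Spec (.of O))
    (f : C ⟶ P') (hf : f ≫ r' = rC) (c : C) (ϖ : O)
    [IsDomain (C.presheaf.stalk c)] [IsDiscreteValuationRing (C.presheaf.stalk c)]
    (hbad : (P'.presheaf.Γgerm (f c)).hom (r'.appTop.hom ((Scheme.ΓSpecIso (.of O)).inv.hom ϖ)) ∈
      (maximalIdeal (P'.presheaf.stalk (f c))) ^ 2) :
    (2 : ℕ∞) ≤ IsDiscreteValuationRing.addVal (C.presheaf.stalk c)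
        ((C.presheaf.Γgerm c).hom (rC.appTop.hom ((Scheme.ΓSpecIso (.of O)).inv.hom ϖ))) ∧
      ¬ Irreducible ((C.presheaf.Γgerm c).hom (rC.appTop.hom ((Scheme.ΓSpecIso (.of O)).inv.hom ϖ))) := by
  have h := varpiGerm_mem_sq_of_over r' rC f hf c ϖ hbad
  exact ⟨by exact_mod_cast le_addVal_of_mem_pow h, not_irreducible_of_mem_sq h⟩

/-- The same in the `Split.GoodAt`-free wording used by DSHARP-VOID §2 (2c): under the hypotheses of `two_le_addVal_varpiGerm_of_bad`, the
germ of `ϖ` at `c` does NOT generate the maximal ideal of the DVR `𝒪_{C,c}` — `C_s` is not reduced at `c`. OURS. [folklore] -/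
theorem maximalIdeal_ne_span_varpiGerm_of_bad {O : Type} [CommRing O] {P' C : Scheme.{0}} (r' : P' ⟶ Spec (.of O))
    (rC : C ⟶ Spec (.of O)) (f : C ⟶ P') (hf : f ≫ r' = rC) (c : C) (ϖ : O)
    [IsDomain (C.presheaf.stalk c)] [IsDiscreteValuationRing (C.presheaf.stalk c)]
    (hbad : (P'.presheaf.Γgerm (f c)).hom (r'.appTop.hom ((Scheme.ΓSpecIso (.of O)).inv.hom ϖ)) ∈
      (maximalIdeal (P'.presheaf.stalk (f c))) ^ 2) :
    maximalIdeal (C.presheaf.stalk c) ≠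
      Ideal.span {(C.presheaf.Γgerm c).hom (rC.appTop.hom ((Scheme.ΓSpecIso (.of O)).inv.hom ϖ))} := by
  intro h
  exact (two_le_addVal_varpiGerm_of_bad r' rC f hf c ϖ hbad).2
    ((IsDiscreteValuationRing.irreducible_iff_uniformizer _).mpr h)

end RibbonMultiplicity

end Summit.ResolutionOfSingularities.ResolutionOfSingularities.Cruxes.EquisingularLiftNat.Sections
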